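import Literature.ModelTheory.ExponentialFields.CylindricalDecomposition
import Literature.NumberTheory.Transcendental.KZLogCalculusProofs
import Summits.KontsevichZagierPeriods.KontsevichZagierPeriods.Theorems.SoloInformedEquidimJunk
import HarnessLib
import HarnessLib.Audit

/-!
# SoloInformed — cells of a `ℚ`-cylindrical decomposition: open or null; splitting a representation along cells (Newton–Leibniz elimination, file 3b)

Solo programme `solo-KontsevichZagierPeriods-informed`, session s245 (K-NF, `paper/nl-elimination.md`
§7.2, FILE 3: the geometric side of THEOREM NF).

The proof of the Newton–Leibniz elimination decomposes `ℝⁿ⁺¹` by a `ℚ`-cylindrical decomposition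
(`IsCylindricalDecomposition ℚ`, [BasuPollackRoy2006, Def. 5.1], existence adapted to finitely many
`ℚ`-semialgebraic sets proved in the tree as
`IsSemialgebraic.exists_cylindricalDecomposition_holds`).  For the KZ calculus only OPEN cells
carry mass: every cell is either open or Lebesgue-null, and a representation splits, modulo the
equidimensional relations `relations₁₂`, into its restrictions to the open cells of any adapted
decomposition.

* `soloInformed_isOpen_bandOver`: a band over an open set cut out by continuous sections is open;
* `soloInformed_cad_isOpen_or_volume_eq_zero`: every cell of a `ℚ`-cylindrical decomposition is open
  or null (induction on the level: graphs are null, bands over null cells are null, bands over open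
  cells are open);
* `soloInformed_exists_bandOver_of_isOpen`: an open cell of level `n + 1` is a band over an OPEN cell;
* `soloInformedCadRep r C` (restriction of `r` to a cell `C ⊆ r.domain`) and
  `soloInformed_of_sub_sum_openCells_mem`: if `r.domain` is the union of the cells `𝒞 ⊆ 𝒯` then
  `[r] − ∑_{C ∈ 𝒞 open} [r|_C] ∈ relations₁₂`.

References: Basu–Pollack–Roy, *Algorithms in real algebraic geometry* (2006), Def. 5.1, Cor. 5.7;
M. Kontsevich, D. Zagier, *Periods* (2001), §1.2; this work (THEOREM NF, `paper/nl-elimination.md`).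
-/

noncomputable section

open scoped BigOperators Topology

namespace Summit.KontsevichZagierPeriods.KontsevichZagierPeriods.Theorems

open Set MeasureTheory Filter
open Literature.ModelTheory.ExponentialFields
open Literature.NumberTheory.Transcendental Literature.NumberTheory.Transcendental.KZ

variable {n : ℕ}

/-! ### Bands over open sets are open -/

/-- The lower boundary of a band, as an `EReal`-valued function of the point of `ℝⁿ⁺¹`, is
continuous on the cylinder over `S` when the sections are continuous on `S`. -/
theorem soloInformed_continuousOn_bandLower {S : Set (Fin n → ℝ)} {l : ℕ}
    {ξ : Fin l → (Fin n → ℝ) → ℝ} (hξ : ∀ i, ContinuousOn (ξ i) S) (j : Fin (l + 1)) :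
    ContinuousOn (fun z : Fin (n + 1) → ℝ => bandLower ξ j (Fin.init z)) {z | Fin.init z ∈ S} := by
  induction j using Fin.cases with
  | zero => simp only [bandLower_zero]; exact continuousOn_const
  | succ i =>
    simp only [bandLower_succ]
    have hinit : Continuous (Fin.init : (Fin (n + 1) → ℝ) → Fin n → ℝ) :=
      continuous_pi fun _ => continuous_apply _
    exact continuous_coe_real_ereal.comp_continuousOn
      ((hξ i).comp hinit.continuousOn fun z hz => hz)

/-- The upper boundary of a band is continuous on the cylinder over `S`. -/
theorem soloInformed_continuousOn_bandUpper {S : Set (Fin n → ℝ)} {l : ℕ}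
    {ξ : Fin l → (Fin n → ℝ) → ℝ} (hξ : ∀ i, ContinuousOn (ξ i) S) (j : Fin (l + 1)) :
    ContinuousOn (fun z : Fin (n + 1) → ℝ => bandUpper ξ j (Fin.init z)) {z | Fin.init z ∈ S} := by
  induction j using Fin.lastCases with
  | last => simp only [bandUpper_last]; exact continuousOn_const
  | cast i =>
    simp only [bandUpper_castSucc]
    have hinit : Continuous (Fin.init : (Fin (n + 1) → ℝ) → Fin n → ℝ) :=
      continuous_pi fun _ => continuous_apply _
    exact continuous_coe_real_ereal.comp_continuousOn
      ((hξ i).comp hinit.continuousOn fun z hz => hz)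

/-- **A band over an open set cut out by continuous sections is open.** [BPR 2006, Def. 5.1] -/
theorem soloInformed_isOpen_bandOver {S : Set (Fin n → ℝ)} (hS : IsOpen S) {l : ℕ}
    {ξ : Fin l → (Fin n → ℝ) → ℝ} (hξ : ∀ i, ContinuousOn (ξ i) S) (j : Fin (l + 1)) :
    IsOpen (bandOver S ξ j) := by
  have hU : IsOpen {z : Fin (n + 1) → ℝ | Fin.init z ∈ S} :=
    hS.preimage (continuous_pi fun _ => continuous_apply _)
  have hlast : ContinuousOn (fun z : Fin (n + 1) → ℝ => ((z (Fin.last n) : ℝ) : EReal))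
      {z | Fin.init z ∈ S} :=
    (continuous_coe_real_ereal.comp (continuous_apply _)).continuousOn
  have hlt : IsOpen {p : EReal × EReal | p.1 < p.2} := isOpen_lt continuous_fst continuous_snd
  have h1 : IsOpen ({z : Fin (n + 1) → ℝ | Fin.init z ∈ S} ∩
      (fun z => (bandLower ξ j (Fin.init z), ((z (Fin.last n) : ℝ) : EReal))) ⁻¹' {p | p.1 < p.2}) :=
    ((soloInformed_continuousOn_bandLower hξ j).prodMk hlast).isOpen_inter_preimage hU hlt
  have h2 : IsOpen ({z : Fin (n + 1) → ℝ | Fin.init z ∈ S} ∩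
      (fun z => (((z (Fin.last n) : ℝ) : EReal), bandUpper ξ j (Fin.init z))) ⁻¹' {p | p.1 < p.2}) :=
    (hlast.prodMk (soloInformed_continuousOn_bandUpper hξ j)).isOpen_inter_preimage hU hlt
  convert h1.inter h2 using 1
  ext z
  simp only [mem_bandOver_iff, mem_inter_iff, mem_setOf_eq, mem_preimage]
  tauto

/-! ### Cells are open or null -/

/-- A band over a null set is null. [folklore] -/
theorem soloInformed_volume_bandOver_eq_zero {S : Set (Fin n → ℝ)} (hS : volume S = 0) {l : ℕ}
    (ξ : Fin l → (Fin n → ℝ) → ℝ) (j : Fin (l + 1)) : volume (bandOver S ξ j) = 0 :=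
  measure_mono_null (fun _ hz => hz.1) (volume_setOf_init_mem_eq_zero hS)

/-- **Every cell of a `ℚ`-cylindrical decomposition is open or Lebesgue-null** (graphs are null,
bands over null cells are null, bands over open cells are open). [BPR 2006, Def. 5.1; folklore] -/
theorem soloInformed_cad_isOpen_or_volume_eq_zero :
    ∀ (n : ℕ) (𝒯 : Finset (Set (Fin n → ℝ))), IsCylindricalDecomposition ℚ n 𝒯 →
      ∀ T ∈ 𝒯, IsOpen T ∨ volume T = 0
  | 0, 𝒯, h, T, hT => by
    have h' : 𝒯 = {univ} := h
    subst h'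
    rw [Finset.mem_singleton] at hT
    subst hT
    exact Or.inl isOpen_univ
  | n + 1, 𝒯, h, T, hT => by
    obtain ⟨-, -, 𝒮, h𝒮, l, ξ, hcont, hsa, -, hmem⟩ := h
    obtain ⟨S, hS, ⟨j, rfl⟩ | ⟨j, rfl⟩⟩ := (hmem T).1 hT
    · exact Or.inr (volume_graph_eq_zero (hsa S hS j))
    · rcases soloInformed_cad_isOpen_or_volume_eq_zero n 𝒮 h𝒮 S hS with hopen | hnull
      · exact Or.inl (soloInformed_isOpen_bandOver hopen (hcont S hS) j)
      · exact Or.inr (soloInformed_volume_bandOver_eq_zero hnull (ξ S) j)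

/-- A non-open cell of a `ℚ`-cylindrical decomposition is null. [BPR 2006, Def. 5.1; folklore] -/
theorem soloInformed_cad_volume_eq_zero_of_not_isOpen {𝒯 : Finset (Set (Fin n → ℝ))}
    (h : IsCylindricalDecomposition ℚ n 𝒯) {T : Set (Fin n → ℝ)} (hT : T ∈ 𝒯) (hno : ¬IsOpen T) :
    volume T = 0 :=
  (soloInformed_cad_isOpen_or_volume_eq_zero n 𝒯 h T hT).resolve_left hno

/-- An open cell has positive volume (cells are nonempty). [BPR 2006, Def. 5.1] -/
theorem soloInformed_cad_volume_ne_zero_of_isOpen {𝒯 : Finset (Set (Fin n → ℝ))}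
    (h : IsCylindricalDecomposition ℚ n 𝒯) {T : Set (Fin n → ℝ)} (hT : T ∈ 𝒯) (hopen : IsOpen T) :
    volume T ≠ 0 := by
  refine hopen.measure_ne_zero volume (nonempty_iff_ne_empty.2 ?_)
  rintro rfl
  exact h.isPartition.1 hT

/-- **Open cells of level `n + 1` are bands over open cells**: given the stack data of a
decomposition `𝒯` over `𝒮`, an open `T ∈ 𝒯` is `bandOver S (ξ S) j` for an OPEN `S ∈ 𝒮`.
[BPR 2006, Def. 5.1; folklore] -/
theorem soloInformed_exists_bandOver_of_isOpen {𝒯 : Finset (Set (Fin (n + 1) → ℝ))}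
    (h𝒯 : IsCylindricalDecomposition ℚ (n + 1) 𝒯) {𝒮 : Finset (Set (Fin n → ℝ))}
    (h𝒮 : IsCylindricalDecomposition ℚ n 𝒮) {l : Set (Fin n → ℝ) → ℕ}
    {ξ : (S : Set (Fin n → ℝ)) → Fin (l S) → (Fin n → ℝ) → ℝ}
    (hsa : ∀ S ∈ 𝒮, ∀ j, IsSemialgebraicFunOn ℚ S (ξ S j))
    (hmem : ∀ T, T ∈ 𝒯 ↔ ∃ S ∈ 𝒮, (∃ j, T = graphOver S (ξ S j)) ∨ ∃ j, T = bandOver S (ξ S) j)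
    {T : Set (Fin (n + 1) → ℝ)} (hT : T ∈ 𝒯) (hopen : IsOpen T) :
    ∃ S ∈ 𝒮, IsOpen S ∧ ∃ j, T = bandOver S (ξ S) j := by
  have hpos := soloInformed_cad_volume_ne_zero_of_isOpen h𝒯 hT hopen
  obtain ⟨S, hS, ⟨j, rfl⟩ | ⟨j, rfl⟩⟩ := (hmem T).1 hT
  · exact absurd (volume_graph_eq_zero (hsa S hS j)) hpos
  · refine ⟨S, hS, ?_, j, rfl⟩
    rcases soloInformed_cad_isOpen_or_volume_eq_zero n 𝒮 h𝒮 S hS with hS' | hnull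
    · exact hS'
    · exact absurd (soloInformed_volume_bandOver_eq_zero hnull (ξ S) j) hpos

/-! ### Splitting a representation along the cells -/

/-- The restriction of `r` to a cell `C` (when `C ⊆ r.domain` is `ℚ`-semialgebraic; otherwise `r`
itself, a junk value never used). [Kontsevich–Zagier 2001, §1.2, rule 1)] -/
def soloInformedCadRep (r : IntegralRep n) (C : Set (Fin n → ℝ)) : IntegralRep n := by
  classical
  exact if h : IsSemialgebraic ℚ C ∧ C ⊆ r.domain then r.restrict C h.1 h.2 else r

/-- The domain of the restriction to a cell. -/
theorem soloInformed_cadRep_domain (r : IntegralRep n) {C : Set (Fin n → ℝ)}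
    (hC : IsSemialgebraic ℚ C) (hsub : C ⊆ r.domain) : (soloInformedCadRep r C).domain = C := by
  classical
  simp only [soloInformedCadRep, dif_pos (And.intro hC hsub)]
  rfl

/-- The integrand of the restriction to a cell is that of `r`. -/
@[simp] theorem soloInformed_cadRep_integrand (r : IntegralRep n) (C : Set (Fin n → ℝ)) :
    (soloInformedCadRep r C).integrand = r.integrand := by
  classical
  unfold soloInformedCadRep
  split_ifs <;> rfl

/-- **Splitting along an adapted decomposition, all cells**: if `r.domain = ⋃₀ 𝒞` for cells
`𝒞 ⊆ 𝒯` of a `ℚ`-cylindrical decomposition then `[r] − ∑_{C ∈ 𝒞} [r|_C] ∈ relations₁₂`.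
[Kontsevich–Zagier 2001, §1.2, rule 1)] -/
theorem soloInformed_of_sub_sum_cells_mem {𝒯 : Finset (Set (Fin n → ℝ))}
    (h𝒯 : IsCylindricalDecomposition ℚ n 𝒯) (r : IntegralRep n) {𝒞 : Finset (Set (Fin n → ℝ))}
    (h𝒞 : 𝒞 ⊆ 𝒯) (hcover : ⋃₀ (𝒞 : Set (Set (Fin n → ℝ))) = r.domain) :
    of r - ∑ C ∈ 𝒞, of (soloInformedCadRep r C) ∈ soloInformedEquidimRelations := by
  have hsa : ∀ C ∈ 𝒞, IsSemialgebraic ℚ C := fun C hC => h𝒯.isSemialgebraic C (h𝒞 hC)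
  have hsub : ∀ C ∈ 𝒞, C ⊆ r.domain := fun C hC => hcover ▸ subset_sUnion_of_mem hC
  have hdom : ∀ C ∈ 𝒞, (soloInformedCadRep r C).domain = C := fun C hC =>
    soloInformed_cadRep_domain r (hsa C hC) (hsub C hC)
  refine soloInformed_of_sub_sum_of_mem_equidimRelations 𝒞 (soloInformedCadRep r) r ?_ ?_ ?_
  · rw [← hcover, sUnion_eq_biUnion]
    exact iUnion₂_congr fun C hC => (hdom C hC).symm
  · intro C hC z _
    rw [soloInformed_cadRep_integrand]
  · intro C hC C' hC' hne
    rw [hdom C hC, hdom C' hC']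
    have hdisj : Disjoint C C' := h𝒯.isPartition.pairwiseDisjoint (h𝒞 hC) (h𝒞 hC') hne
    rw [hdisj.inter_eq, measure_empty]

open Classical in
/-- **Splitting along an adapted decomposition, open cells only**: the non-open cells are null,
hence junk, so `[r] − ∑_{C ∈ 𝒞, C open} [r|_C] ∈ relations₁₂`.
[Kontsevich–Zagier 2001, §1.2, rule 1); BPR 2006, Cor. 5.7] -/
theorem soloInformed_of_sub_sum_openCells_mem {𝒯 : Finset (Set (Fin n → ℝ))}
    (h𝒯 : IsCylindricalDecomposition ℚ n 𝒯) (r : IntegralRep n) {𝒞 : Finset (Set (Fin n → ℝ))}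
    (h𝒞 : 𝒞 ⊆ 𝒯) (hcover : ⋃₀ (𝒞 : Set (Set (Fin n → ℝ))) = r.domain) :
    of r - ∑ C ∈ 𝒞.filter IsOpen, of (soloInformedCadRep r C) ∈ soloInformedEquidimRelations := by
  have h1 := soloInformed_of_sub_sum_cells_mem h𝒯 r h𝒞 hcover
  rw [← Finset.sum_filter_add_sum_filter_not 𝒞 IsOpen] at h1
  -- the non-open cells are null, hence junk
  have h2 : ∑ C ∈ 𝒞.filter (fun C => ¬IsOpen C), of (soloInformedCadRep r C) ∈
      soloInformedEquidimRelations := by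
    refine AddSubgroup.sum_mem _ fun C hC => ?_
    rw [Finset.mem_filter] at hC
    refine soloInformed_of_mem_equidimRelations_of_volume_eq_zero _ ?_
    rw [soloInformed_cadRep_domain r (h𝒯.isSemialgebraic C (h𝒞 hC.1))
      (hcover ▸ subset_sUnion_of_mem hC.1)]
    exact soloInformed_cad_volume_eq_zero_of_not_isOpen h𝒯 (h𝒞 hC.1) hC.2
  have h3 := soloInformedEquidimRelations.add_mem h1 h2
  rwa [sub_add_eq_sub_sub, sub_add_cancel] at h3

end Summit.KontsevichZagierPeriods.KontsevichZagierPeriods.Theorems
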